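import Mathlib
import Summits.KontsevichZagierPeriods.KontsevichZagierPeriods.Theorems.SoloInformedScaleStep
import Summits.KontsevichZagierPeriods.KontsevichZagierPeriods.Theorems.SoloInformedHoffmanLabels
import Summits.KontsevichZagierPeriods.KontsevichZagierPeriods.Theorems.SoloInformedZetaFourStep
import HarnessLib
import HarnessLib.Audit

/-!
# SoloInformed — Hoffman's relation: the scale datum and its series side (file 2)

Solo programme `solo-KontsevichZagierPeriods-informed`, session s48 (PROGRAMME L).
For an admissible index `u = (u₀, …, u_k)` of weight `m + 1` we instantiate the SCALE BAND STEP
(THEOREM XLIX, `SoloInformedScaleDatum.scale`) in dimension `m + 2` — cube coordinates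
`x₀, …, x_m` of the word of `u` and one extra coordinate `Y = x_{m+1}` — with active slot `x₀`,
`Φ = G(Q₀, …, Q_k)` (the chain function of the `u`-prefix products, i.e. the cube integrand of
`ζ(u)`), passive `ω = Y`, `C = 1`:
`A = [(0,1)^{m+2} ∩ {Y < x₀}, G(Q)/(1 − Y)]`, `B = [(0,1)^{m+2}, (G(Q) − Y·G(Q·Y))/(1 − Y)]`.
Scaling `x₀` by `Y` scales every `Q_t` by `Y`, and the `p = 0` case of the deformed harmonic
identity (`soloInformed_harmonicGQ_aux`) reads
`(G(Q) − Y G(QY))/(1 − Y) = Σ_{1 ≤ i ≤ k+1} G(ins_i(Y; Q)) + Σ_{0 ≤ i ≤ k} G(merge_i(Y; Q))`,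
the sum of the cube integrands of `ζ(u₀,…,u_{i-1}, 1, u_i, …)` and `ζ(…, u_i + 1, …)` (file 1,
letter of size `1`).  Hence, by rule (1b),
`⟦B⟧ = Σ_{i=1}^{k+1} mzvClass (u.take i ++ 1 :: u.drop i) + Σ_{i=0}^{k} mzvClass (u.take i ++ (1+u_i) :: u.drop (i+1))`
(`soloInformed_hofB_class`) — the SERIES side `Σₙ ζ⋆`-type of Kaneko–Yamamoto's integral–series
identity for the index `((1), u)`.  File 3 treats `A` (the garland integral), file 4 assembles
Hoffman's relation.

References: M. Hoffman, Pacific J. Math. 152 (1992) Thm 5.1; M. Kaneko, S. Yamamoto,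
arXiv:1605.03117, Thm 4.1; Kontsevich–Zagier 2001 §1.2.
-/

noncomputable section

open MeasureTheory Set MvPolynomial
open Literature.ModelTheory.ExponentialFields Literature.NumberTheory.Transcendental
open Literature.NumberTheory.Transcendental.KZ

namespace Summit.KontsevichZagierPeriods.KontsevichZagierPeriods.Theorems

/-! ## 1. The prefix-product polynomials -/

section polys

variable (u : List ℕ) (m : ℕ)

/-- The `u`-prefix product `Q_t = ∏_{l < J_{t+1}} X_l` as a polynomial in `m + 2` variables. -/
def soloInformedQUP (t : ℕ) : MvPolynomial (Fin (m + 2)) ℚ :=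
  ∏ l ∈ Finset.univ.filter (fun l : Fin (m + 2) => l.1 < (soloInformedEnds u).getD t 0), X l

/-- The rest of `Q_t` after the active coordinate: `R_t(w) = ∏_{0 < l < J_{t+1}} w_l`. -/
def soloInformedQUR (w : Fin (m + 2) → ℝ) (t : ℕ) : ℝ :=
  ∏ l ∈ (Finset.univ.filter (fun l : Fin (m + 2) => l.1 < (soloInformedEnds u).getD t 0)).erase 0, w l

/-- `aeval w Q_t = Q_t(w)`. -/
theorem soloInformed_aeval_QUP (w : Fin (m + 2) → ℝ) (t : ℕ) :
    (aeval w (soloInformedQUP u m t) : ℝ) = soloInformedQU (m + 1) u w t := by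
  simp [soloInformedQUP, soloInformedQU, map_prod]

variable {u m} {k : ℕ} (hu : MZV.IsAdmissible u) (hw : MZV.weight u = m + 1) (hk : u.length = k + 1)
include hu hw hk

/-- `J_{t+1} ≥ 2` for `t ≤ k` (block `0` has `u₀ ≥ 2` letters). -/
theorem soloInformed_two_le_ends {t : ℕ} (ht : t ≤ k) : 2 ≤ (soloInformedEnds u).getD t 0 := by
  rw [soloInformed_ends_getD (by omega : t < u.length)]
  obtain ⟨a, u', rfl⟩ := List.exists_cons_of_ne_nil (List.ne_nil_of_length_eq_add_one hk)
  have ha : 2 ≤ a := hu.2 (List.cons_ne_nil a u')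
  rw [List.take_succ_cons, List.sum_cons]
  omega

/-- `Q_t(w|w₀ ↦ v) = v · R_t(w)` for `t ≤ k`. -/
theorem soloInformed_QU_update_zero (w : Fin (m + 2) → ℝ) (v : ℝ) {t : ℕ} (ht : t ≤ k) :
    soloInformedQU (m + 1) u (Function.update w 0 v) t = v * soloInformedQUR u m w t := by
  have h2 := soloInformed_two_le_ends hu hw hk ht
  have h0 : (0 : Fin (m + 2)) ∈ Finset.univ.filter
      (fun l : Fin (m + 2) => l.1 < (soloInformedEnds u).getD t 0) := by
    simp only [Finset.mem_filter, Finset.mem_univ, true_and, Fin.val_zero]; omega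
  unfold soloInformedQU soloInformedQUR
  rw [← Finset.mul_prod_erase _ _ h0, Function.update_self]
  congr 1
  exact Finset.prod_congr rfl fun l hl => by rw [Function.update_of_ne (Finset.mem_erase.1 hl).1]

/-- `Q_t(w) = w₀ · R_t(w)` for `t ≤ k`. -/
theorem soloInformed_QU_eq_mul (w : Fin (m + 2) → ℝ) {t : ℕ} (ht : t ≤ k) :
    soloInformedQU (m + 1) u w t = w 0 * soloInformedQUR u m w t := by
  conv_lhs => rw [← Function.update_eq_self (0 : Fin (m + 2)) w]
  exact soloInformed_QU_update_zero hu hw hk w (w 0) ht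

/-- On the cube `0 < R_t < 1` for `t ≤ k` (the factor `w₁ < 1` is present). -/
theorem soloInformed_QUR_mem {w : Fin (m + 2) → ℝ} (hwc : w ∈ soloInformedOpenCube (m + 2)) {t : ℕ}
    (ht : t ≤ k) : 0 < soloInformedQUR u m w t ∧ soloInformedQUR u m w t < 1 := by
  have h2 := soloInformed_two_le_ends hu hw hk ht
  exact soloInformed_prod_filter_mem_Ioo hwc ⟨⟨1, by omega⟩, Finset.mem_erase.2
    ⟨by simp, Finset.mem_filter.2 ⟨Finset.mem_univ _, by simp only; omega⟩⟩⟩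

end polys

/-! ## 2. The numerator and denominator of `Φ = G(Q)` -/

section phi

variable (u : List ℕ) (m k : ℕ)

/-- `P = ∏_{t<k} Q_t`. -/
def soloInformedHofP : MvPolynomial (Fin (m + 2)) ℚ := ∏ t : Fin k, soloInformedQUP u m t

/-- `Q = ∏_{t≤k} (1 − Q_t)`. -/
def soloInformedHofQ : MvPolynomial (Fin (m + 2)) ℚ := ∏ t : Fin (k + 1), (1 - soloInformedQUP u m t)

/-- **`P/Q = G(Q₀, …, Q_k)`** (an unconditional identity of the field operations). -/
theorem soloInformed_hof_phi (w : Fin (m + 2) → ℝ) :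
    (aeval w (soloInformedHofP u m k) : ℝ) / aeval w (soloInformedHofQ u m k) =
      soloInformedGQ (List.ofFn fun t : Fin (k + 1) => soloInformedQU (m + 1) u w t) := by
  rw [soloInformedGQ_ofFn, soloInformedHofP, soloInformedHofQ, map_prod, map_prod, Finset.prod_div_distrib,
    div_mul_div_comm, mul_one]
  simp only [map_sub, map_one, soloInformed_aeval_QUP, Fin.val_castSucc, Fin.val_last]
  rw [Fin.prod_univ_castSucc fun t : Fin (k + 1) => 1 - soloInformedQU (m + 1) u w t]
  simp only [Fin.val_castSucc, Fin.val_last]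

variable {u m k} (hu : MZV.IsAdmissible u) (hw : MZV.weight u = m + 1) (hk : u.length = k + 1)
include hu hw hk

/-- `aeval (w|w₀ ↦ v) P = ∏_{t<k} v R_t(w)`. -/
theorem soloInformed_aeval_hofP_update (w : Fin (m + 2) → ℝ) (v : ℝ) :
    (aeval (Function.update w 0 v) (soloInformedHofP u m k) : ℝ) =
      ∏ t : Fin k, v * soloInformedQUR u m w t := by
  rw [soloInformedHofP, map_prod]
  exact Finset.prod_congr rfl fun t _ => by
    rw [soloInformed_aeval_QUP, soloInformed_QU_update_zero hu hw hk w v (by omega)]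

/-- `aeval (w|w₀ ↦ v) Q = ∏_{t≤k} (1 − v R_t(w))`. -/
theorem soloInformed_aeval_hofQ_update (w : Fin (m + 2) → ℝ) (v : ℝ) :
    (aeval (Function.update w 0 v) (soloInformedHofQ u m k) : ℝ) =
      ∏ t : Fin (k + 1), (1 - v * soloInformedQUR u m w t) := by
  rw [soloInformedHofQ, map_prod]
  exact Finset.prod_congr rfl fun t _ => by
    rw [map_sub, map_one, soloInformed_aeval_QUP, soloInformed_QU_update_zero hu hw hk w v (by omega)]

/-- On the cube and for `0 ≤ v ≤ 1`: `aeval (w|w₀ ↦ v) Q > 0`. -/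
theorem soloInformed_aeval_hofQ_update_pos {w : Fin (m + 2) → ℝ}
    (hwc : w ∈ soloInformedOpenCube (m + 2)) {v : ℝ} (_hv0 : 0 ≤ v) (hv1 : v ≤ 1) :
    0 < (aeval (Function.update w 0 v) (soloInformedHofQ u m k) : ℝ) := by
  rw [soloInformed_aeval_hofQ_update hu hw hk]
  exact Finset.prod_pos fun t _ => by
    have hR := soloInformed_QUR_mem hu hw hk hwc (t := t) (by omega)
    nlinarith [hR.1, hR.2]

/-- **Monotonicity of `v ↦ v·Φ(w|w₀ ↦ v)` on `[0,1]`** (numerator nondecreasing and nonnegative,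
denominator positive and nonincreasing). -/
theorem soloInformed_hof_mono {w : Fin (m + 2) → ℝ} (hwc : w ∈ soloInformedOpenCube (m + 2)) :
    MonotoneOn (fun v : ℝ => v * ((aeval (Function.update w 0 v) (soloInformedHofP u m k) : ℝ) /
      aeval (Function.update w 0 v) (soloInformedHofQ u m k))) (Icc 0 1) := by
  intro s hs t ht hst
  simp only
  rw [mul_div_assoc', mul_div_assoc']
  have hR : ∀ r : ℕ, r ≤ k → 0 < soloInformedQUR u m w r ∧ soloInformedQUR u m w r < 1 :=
    fun r hr => soloInformed_QUR_mem hu hw hk hwc hr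
  have hN : ∀ v : ℝ, 0 ≤ v → 0 ≤ v * (aeval (Function.update w 0 v) (soloInformedHofP u m k) : ℝ) :=
    fun v hv => by
      rw [soloInformed_aeval_hofP_update hu hw hk]
      exact mul_nonneg hv (Finset.prod_nonneg fun r _ => mul_nonneg hv (hR r (by omega)).1.le)
  have hNle : s * (aeval (Function.update w 0 s) (soloInformedHofP u m k) : ℝ) ≤
      t * aeval (Function.update w 0 t) (soloInformedHofP u m k) := by
    rw [soloInformed_aeval_hofP_update hu hw hk, soloInformed_aeval_hofP_update hu hw hk]
    refine mul_le_mul hst (Finset.prod_le_prod (fun r _ => mul_nonneg hs.1 (hR r (by omega)).1.le)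
      fun r _ => mul_le_mul_of_nonneg_right hst (hR r (by omega)).1.le)
      (Finset.prod_nonneg fun r _ => mul_nonneg hs.1 (hR r (by omega)).1.le) ht.1
  have hDle : (aeval (Function.update w 0 t) (soloInformedHofQ u m k) : ℝ) ≤
      aeval (Function.update w 0 s) (soloInformedHofQ u m k) := by
    rw [soloInformed_aeval_hofQ_update hu hw hk, soloInformed_aeval_hofQ_update hu hw hk]
    refine Finset.prod_le_prod (fun r _ => ?_) fun r _ => ?_
    · have := hR r (by omega); nlinarith [ht.2]
    · have := hR r (by omega); nlinarith
  exact div_le_div₀ (hN t ht.1) hNle (soloInformed_aeval_hofQ_update_pos hu hw hk hwc ht.1 ht.2) hDle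

end phi

/-! ## 3. The term representations (letter of size `1`) -/

section terms

variable {u : List ℕ} {m k : ℕ} (hu : MZV.IsAdmissible u) (hw : MZV.weight u = m + 1)
  (hk : u.length = k + 1)

/-- The insertion term `HfIns i = BRep (LabIns (i+1))`, `0 ≤ i ≤ k` (letter `1` after block `i`). -/
def soloInformedHfIns (i : Fin (k + 1)) : IntegralRep (m + 2) :=
  soloInformedBRep (soloInformedLabIns (m + 1) u m (i + 1))
    (soloInformed_isLab_labInsC (m + 1) (c := 1) hu hw hk rfl le_rfl (Nat.succ_pos i) (by omega))

/-- The merging term `HfMerge i = BRep (LabMerge i)`, `0 ≤ i ≤ k` (letter `1` into block `i`). -/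
def soloInformedHfMerge (i : Fin (k + 1)) : IntegralRep (m + 2) :=
  soloInformedBRep (soloInformedLabMerge (m + 1) u m i)
    (soloInformed_isLab_labMergeC (m + 1) (c := 1) hu hw hk rfl (Nat.le_of_lt_succ i.2))

/-- The integrand of `HfIns i` is `G(ins_{i+1}(Y; Q))`. -/
theorem soloInformed_hfIns_integrand (i : Fin (k + 1)) (w : Fin (m + 2) → ℝ) :
    (soloInformedHfIns hu hw hk i).integrand w =
      soloInformedGQ (soloInformedInsQ (w (Fin.last (m + 1))) 1
        (List.ofFn fun t : Fin (k + 1) => soloInformedQU (m + 1) u w t) (i + 1)) := by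
  rw [soloInformedHfIns, soloInformed_bRep_integrand]
  exact congrArg soloInformedGQ (soloInformed_ofFn_BP_labIns_one hu hw hk ⟨i + 1, by omega⟩ w)

/-- The integrand of `HfMerge i` is `G(merge_i(Y; Q))`. -/
theorem soloInformed_hfMerge_integrand (i : Fin (k + 1)) (w : Fin (m + 2) → ℝ) :
    (soloInformedHfMerge hu hw hk i).integrand w =
      soloInformedGQ (soloInformedMergeQ (w (Fin.last (m + 1)))
        (List.ofFn fun t : Fin (k + 1) => soloInformedQU (m + 1) u w t) i) := by
  rw [soloInformedHfMerge, soloInformed_bRep_integrand, soloInformed_ofFn_BP_labMerge_one hu hw hk i w]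

/-- `⟦HfIns i⟧ = mzvClass (u.take (i+1) ++ 1 :: u.drop (i+1))`. -/
theorem soloInformed_hfIns_class (i : Fin (k + 1)) :
    toFormalPeriod (of (soloInformedHfIns hu hw hk i)) =
      mzvClass (u.take (i + 1) ++ 1 :: u.drop (i + 1)) := by
  rw [soloInformedHfIns, soloInformed_bRep_class,
    soloInformed_idx_labInsC (m + 1) (c := 1) hu hw hk rfl (by omega)]

/-- `⟦HfMerge i⟧ = mzvClass (u.take i ++ (1 + u_i) :: u.drop (i+1))`. -/
theorem soloInformed_hfMerge_class (i : Fin (k + 1)) :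
    toFormalPeriod (of (soloInformedHfMerge hu hw hk i)) =
      mzvClass (u.take i ++ (1 + u[(i : ℕ)]'(by omega)) :: u.drop (i + 1)) := by
  rw [soloInformedHfMerge, soloInformed_bRep_class,
    soloInformed_idx_labMergeC (m + 1) (c := 1) hu hw hk rfl (Nat.le_of_lt_succ i.2)]

/-- The domains of the terms are the cube. -/
theorem soloInformed_hfIns_domain (i : Fin (k + 1)) :
    (soloInformedHfIns hu hw hk i).domain = soloInformedOpenCube (m + 2) := soloInformed_bRep_domain _ _

/-- The domains of the terms are the cube. -/
theorem soloInformed_hfMerge_domain (i : Fin (k + 1)) :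
    (soloInformedHfMerge hu hw hk i).domain = soloInformedOpenCube (m + 2) := soloInformed_bRep_domain _ _

include hu hw hk in
/-- **The pointwise identity on the cube**:
`(G(Q) − Y G(QY))/(1·(1 − Y)) = Σᵢ G(ins_{i+1}) + Σᵢ G(mergeᵢ)`, `Y = w_{m+1}`. -/
theorem soloInformed_hof_fB_eq_sum {w : Fin (m + 2) → ℝ} (hwc : w ∈ soloInformedOpenCube (m + 2)) :
    soloInformedScaleFB 0 (soloInformedHofP u m k) (soloInformedHofQ u m k) (X (Fin.last (m + 1))) 1 w =
      ∑ i : Fin (k + 1), (soloInformedHfIns hu hw hk i).integrand w +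
        ∑ i : Fin (k + 1), (soloInformedHfMerge hu hw hk i).integrand w := by
  set Y : ℝ := w (Fin.last (m + 1)) with hYdef
  set L : List ℝ := List.ofFn fun t : Fin (k + 1) => soloInformedQU (m + 1) u w t with hL
  have hY : 0 ≤ Y ∧ Y < 1 := ⟨(hwc _).1.le, (hwc _).2⟩
  have hQmem : ∀ t : ℕ, t ≤ k → 0 < soloInformedQU (m + 1) u w t ∧ soloInformedQU (m + 1) u w t < 1 :=
    fun t ht => by
      rw [soloInformed_QU_eq_mul hu hw hk w ht]
      have hR := soloInformed_QUR_mem hu hw hk hwc ht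
      exact ⟨mul_pos (hwc 0).1 hR.1, by nlinarith [(hwc 0).1, (hwc 0).2, hR.1, hR.2]⟩
  have hLmem : ∀ q ∈ L, 0 ≤ q ∧ q < 1 := by
    intro q hq
    rw [hL, List.mem_ofFn] at hq
    obtain ⟨t, rfl⟩ := hq
    have := hQmem t (by omega)
    exact ⟨this.1.le, this.2⟩
  -- the scaled chain
  have hscaled : (List.ofFn fun t : Fin (k + 1) =>
      soloInformedQU (m + 1) u (Function.update w 0 (Y * w 0)) t) = L.map (· * Y) := by
    rw [hL, List.map_ofFn]
    refine List.ofFn_inj.2 (funext fun t => ?_)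
    simp only [Function.comp_apply]
    rw [soloInformed_QU_update_zero hu hw hk w _ (by omega), soloInformed_QU_eq_mul hu hw hk w (by omega)]
    ring
  -- the identity at `p = 0`
  have hid := soloInformed_harmonicGQ_aux hY L 0 hLmem le_rfl zero_le_one
  have hlen : L.length = k + 1 := by rw [hL, List.length_ofFn]
  rw [hlen, Finset.sum_range_succ' _ (k + 1)] at hid
  have hins0 : soloInformedGQ (soloInformedInsQ Y 0 L 0) = 0 := by
    rw [soloInformedInsQ_zero, soloInformedGQ_cons (by rw [hL]; simp)]
    simp
  have hinsS : ∀ i : ℕ, soloInformedInsQ Y 0 L (i + 1) = soloInformedInsQ Y 1 L (i + 1) := fun i => by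
    rw [hL, List.ofFn_succ, soloInformedInsQ_cons_succ, soloInformedInsQ_cons_succ]
  rw [hins0, add_zero, Finset.sum_range, Finset.sum_range] at hid
  simp only [hinsS] at hid
  -- the left-hand side
  have h1Y : (1 : ℝ) - Y ≠ 0 := by linarith [hY.2]
  unfold soloInformedScaleFB
  rw [aeval_X, map_one, ← hYdef, soloInformed_hof_phi, soloInformed_hof_phi, hscaled, ← hL]
  simp only [soloInformed_hfIns_integrand, soloInformed_hfMerge_integrand, ← hYdef, ← hL]
  rw [hid]
  field_simp
  ring

end terms

/-! ## 4. The datum -/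

section datum

variable {u : List ℕ} {m k : ℕ} (hu : MZV.IsAdmissible u) (hw : MZV.weight u = m + 1)
  (hk : u.length = k + 1)

/-- **The Hoffman scale datum** of an admissible index `u` of weight `m+1` with `k+1` blocks. -/
def soloInformedHofDatum : SoloInformedScaleDatum (m + 2) where
  i := 0
  P := soloInformedHofP u m k
  Q := soloInformedHofQ u m k
  Ω := X (Fin.last (m + 1))
  C := 1
  D := soloInformedOpenCube (m + 2)
  isSemialgebraic_D := isSemialgebraic_soloInformedOpenCube _
  update_mem x hx t h0 h1 j := by
    by_cases hj : j = 0
    · subst hj; simp [h0, h1]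
    · rw [Function.update_of_ne hj]; exact hx j
  mem_Ioo x hx := hx 0
  vars_Ω := by
    rw [vars_X, Finset.mem_singleton]
    exact fun h => by simp at h
  vars_C := by simp [vars]
  Ω_bound x hx := by simpa using hx (Fin.last (m + 1))
  C_pos x _ := by simp
  Q_ne x hx t ht := (soloInformed_aeval_hofQ_update_pos hu hw hk hx ht.1 ht.2).ne'
  mono x hx := soloInformed_hof_mono hu hw hk hx
  integrableOn_fB := by
    have h : IntegrableOn (fun w => ∑ i : Fin (k + 1), (soloInformedHfIns hu hw hk i).integrand w +
        ∑ i : Fin (k + 1), (soloInformedHfMerge hu hw hk i).integrand w) (soloInformedOpenCube (m + 2)) := by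
      refine IntegrableOn.add (integrable_finsetSum _ fun i _ => ?_)
        (integrable_finsetSum _ fun i _ => ?_)
      · have := (soloInformedHfIns hu hw hk i).integrableOn
        rwa [soloInformed_hfIns_domain] at this
      · have := (soloInformedHfMerge hu hw hk i).integrableOn
        rwa [soloInformed_hfMerge_domain] at this
    exact h.congr_fun (fun w hw' => (soloInformed_hof_fB_eq_sum hu hw hk hw').symm)
      (soloInformed_measurableSet_openCube _)

/-- Auxiliary (Hoffman datum): `repB` lives on the cube. -/
@[simp] theorem soloInformed_hofDatum_repB_domain :
    (soloInformedHofDatum hu hw hk).repB.domain = soloInformedOpenCube (m + 2) := rfl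

/-- Auxiliary (Hoffman datum): the active slot. -/
@[simp] theorem soloInformed_hofDatum_i : (soloInformedHofDatum hu hw hk).i = 0 := rfl

/-- Auxiliary (Hoffman datum): `ω = Y`. -/
@[simp] theorem soloInformed_hofDatum_ω (x : Fin (m + 2) → ℝ) :
    (soloInformedHofDatum hu hw hk).ω x = x (Fin.last (m + 1)) := by
  simp [SoloInformedScaleDatum.ω, soloInformedHofDatum]

/-- Auxiliary (Hoffman datum): `C = 1`. -/
@[simp] theorem soloInformed_hofDatum_cc (x : Fin (m + 2) → ℝ) :
    (soloInformedHofDatum hu hw hk).cc x = 1 := by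
  simp [SoloInformedScaleDatum.cc, soloInformedHofDatum]

/-- Auxiliary (Hoffman datum): `Φ = G(Q)`. -/
theorem soloInformed_hofDatum_φ (x : Fin (m + 2) → ℝ) :
    (soloInformedHofDatum hu hw hk).φ x =
      soloInformedGQ (List.ofFn fun t : Fin (k + 1) => soloInformedQU (m + 1) u x t) :=
  soloInformed_hof_phi u m k x

/-- **`repA = [(0,1)^{m+2} ∩ {Y < x₀}, G(Q)/(1 − Y)]`**: the domain. -/
theorem soloInformed_hofDatum_repA_domain : (soloInformedHofDatum hu hw hk).repA.domain =
    soloInformedOpenCube (m + 2) ∩ {x | x (Fin.last (m + 1)) < x 0} := by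
  rw [SoloInformedScaleDatum.repA_domain]
  ext x
  simp [soloInformedHofDatum, SoloInformedScaleDatum.ω]

/-- **`repA`**: the integrand. -/
theorem soloInformed_hofDatum_repA_integrand (x : Fin (m + 2) → ℝ) :
    (soloInformedHofDatum hu hw hk).repA.integrand x =
      soloInformedGQ (List.ofFn fun t : Fin (k + 1) => soloInformedQU (m + 1) u x t) /
        (1 - x (Fin.last (m + 1))) := by
  rw [SoloInformedScaleDatum.repA_integrand, SoloInformedScaleDatum.fA, soloInformed_hofDatum_φ,
    soloInformed_hofDatum_cc, soloInformed_hofDatum_ω, one_mul]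

/-! ## 5. The class of `B` -/

/-- **`[B] − (Σ [HfIns i] + Σ [HfMerge i]) ∈ relations`** (rule (1b), `2k+2` summands). -/
theorem soloInformed_hofB_move :
    of (soloInformedHofDatum hu hw hk).repB -
      (∑ i : Fin (k + 1), of (soloInformedHfIns hu hw hk i) +
        ∑ i : Fin (k + 1), of (soloInformedHfMerge hu hw hk i)) ∈ relations := by
  have h := soloInformed_of_sub_sum_mem_relations (soloInformedHofDatum hu hw hk).repB
    (Fin.addCases (fun i : Fin (k + 1) => soloInformedHfIns hu hw hk i)
      fun i : Fin (k + 1) => soloInformedHfMerge hu hw hk i)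
    (fun i => by
      rw [soloInformed_hofDatum_repB_domain]
      induction i using Fin.addCases with
      | left i => rw [Fin.addCases_left]; exact soloInformed_bRep_domain _ _
      | right i => rw [Fin.addCases_right]; exact soloInformed_bRep_domain _ _)
    (fun w hwc => by
      rw [soloInformed_hofDatum_repB_domain] at hwc
      dsimp only
      rw [Fin.sum_univ_add]
      simp only [Fin.addCases_left, Fin.addCases_right]
      exact soloInformed_hof_fB_eq_sum hu hw hk hwc)
  rw [Fin.sum_univ_add] at h
  simpa only [Fin.addCases_left, Fin.addCases_right] using h

/-- **`⟦B⟧ = Σ_{i=0}^{k} mzvClass (u.take (i+1) ++ 1 :: u.drop (i+1)) + Σ_{i=0}^{k} mzvClass (u.take i ++ (1+u_i) :: u.drop (i+1))`.** -/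
theorem soloInformed_hofB_class :
    toFormalPeriod (of (soloInformedHofDatum hu hw hk).repB) =
      ∑ i : Fin (k + 1), mzvClass (u.take (i + 1) ++ 1 :: u.drop (i + 1)) +
        ∑ i : Fin (k + 1), mzvClass (u.take i ++ (1 + u[(i : ℕ)]'(by omega)) :: u.drop (i + 1)) := by
  have h := toFormalPeriod_eq_iff.2 (soloInformed_hofB_move hu hw hk)
  rw [map_add, map_sum, map_sum] at h
  rw [h]
  simp only [soloInformed_hfIns_class, soloInformed_hfMerge_class]

end datum

end Summit.KontsevichZagierPeriods.KontsevichZagierPeriods.Theorems
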